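import Summits.CriticalPhenomena.PercolationContinuityZ3.Theorems.PercNearOneGluingNoHeavyQuantWindowPairDeep
import HarnessLib

/-!
# QUANT lane R8, T-DEC: the window pair with transfer (`LawDec.SliceLawSW`, MID case `T + ag ≤ 2h`, `h′ = h`) — part 4:
# the SHALLOW cells S-A / S-B / S-C (the shifted low copy `l + a` is self-sufficient: `T + ag ≤ 2(l+a)`) and the whole MID case

builds on p205010 (kernel theorem, internal audit signed; external expert review pending)

Support file (`--supports stmt-CriticalPhenomena-4575`), QUANT lane seat prim-quant-census-1 (gen 20), rung R8 of
`run/shared/lean/prim/quant/LADDER.md`.  Theorems only, standard axioms, no sorries.  Memo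
`run/shared/lean/prim/quant/prim-quant-census-1/SLICELAWSW-G20.md` §2–§3.

SHALLOW (`T′ = T + ag ≤ 2(l+a)`): the shifted low copy `l + a` is a point component, except that when the VERTICAL pair `(l, l+a)` is
compatible (`T′ < 2l + a`) it absorbs `v = B(1−ρᵥ)/ρᵥ` of the row-0 low at the (heavy) gate `ρᵥ = (T′ − 2l)/a ≥ g ≥ x`, filling
`l + a` exactly.  The rest `R` of the row-0 low (`R = (1−γ)(1−g)` without the vertical pair, `R(ρ + w) = (1−x)pρ` with it) is routed as
in the deep cells: S-A (row-0 pair light) into `h` with `t = t_max`; S-B (not light, `Rx ≤ γg(1−x)`) into the giant; S-C (heavy,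
compatible, `Rx > γg(1−x)`) giant filled + heavy pair into `h`, `t = 0`; the incompatible case forces S-B (`poly_SXv`, `windowPair_SXn`).
The cells are written once for an abstract vertical block `(R, λᵥ, π_a, γᵥ)` and instantiated twice.

* `LawDec.windowPair_SXn` — the hand-proved emptiness lemma (no Handelman certificate exists: tight to second order at `x = g = 1/2`).
* `LawDec.windowPair_shallow_A / _B / _C` — the three cells over an abstract vertical block.
* **`LawDec.windowPair_shallow`** — every shallow MID instance; **`LawDec.windowPair_mid`** — every MID instance (`h′ = h`).

[this work].  Nothing here is cited as a published result.  The gluing rows served [cite: KozmaNitzan2024, Conjecture 3 (p. 15)];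
product measure [cite: Grimmett1999, §1.3 p. 10].
-/

noncomputable section

namespace Summit.CriticalPhenomena.PercolationContinuityZ3.Theorems

namespace Quant

open Finset

namespace LawDec

/-! ### The hand-proved cell S-X (no vertical pair) -/

/-- **Lemma Q / cell S-X without vertical pair**: in the coordinates `p, w`, if the row-0 pair is incompatible (`w ≥ p − x`) and
the vertical pair is unavailable (`g(1 + x − p + w) ≥ w`) then `p ≤ x + g`, and hence `(1−x)·(g − p(x + g − 2gx)) ≥ 0`, i.e.
`(1−γ)(1−g)x ≤ γg(1−x)`: the giant can take the whole row-0 low.  (Proof: `g − p(x+g−2gx) ≥ g − (x+g)(x+g−2gx)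
= g(1−g)(1−2x) + x²(2g−1) ≥ 0` by a three-way case split in `x, g ≶ 1/2`; no nonnegative polynomial certificate exists.) [this work] -/
theorem windowPair_SXn (x g p w : ℝ) (hx0 : 0 ≤ x) (hx1 : x ≤ 1) (hxg : x ≤ g) (hg1 : g ≤ 1)
    (hincompat0 : p - x ≤ w) (hnovert : w ≤ g * (1 + x - p + w)) :
    0 ≤ (1 - (1 - x) * p) * g * (1 - x) - (1 - x) * p * (1 - g) * x := by
  have hpg : p ≤ x + g := by nlinarith [mul_nonneg (sub_nonneg.2 hg1) (sub_nonneg.2 hincompat0)]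
  have hk : 0 ≤ x + g - 2 * g * x := by nlinarith
  have hE : 0 ≤ g * (1 - g) * (1 - 2 * x) + x ^ 2 * (2 * g - 1) := by
    -- E(x,g) - E(x,x) = (g - x)((1-2x)(1-g-x) + 2x²),  E(x,x) = x(1-2x)²
    have hid : g * (1 - g) * (1 - 2 * x) + x ^ 2 * (2 * g - 1)
        = x * (1 - 2 * x) ^ 2 + (g - x) * ((1 - 2 * x) * (1 - g - x) + 2 * x ^ 2) := by ring
    rcases le_or_gt x (1/2) with hxh | hxh
    · rcases le_or_gt g (1/2) with hgh | hgh
      · rw [hid]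
        have h1 : 0 ≤ (1 - 2 * x) * (1 - g - x) := mul_nonneg (by linarith) (by linarith)
        nlinarith [sq_nonneg (1 - 2 * x), mul_nonneg (sub_nonneg.2 hxg) h1, sq_nonneg x]
      · -- x ≤ 1/2 ≤ g: both summands are nonnegative
        nlinarith [mul_nonneg (mul_nonneg (le_trans hx0 hxg) (sub_nonneg.2 hg1)) (by linarith : (0:ℝ) ≤ 1 - 2 * x),
          mul_nonneg (sq_nonneg x) (by linarith : (0:ℝ) ≤ 2 * g - 1)]
    · rw [hid]
      have h1 : 0 ≤ (1 - 2 * x) * (1 - g - x) := by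
        have : 0 ≤ (2 * x - 1) * (g + x - 1) := mul_nonneg (by linarith) (by linarith)
        nlinarith
      nlinarith [sq_nonneg (1 - 2 * x), mul_nonneg (sub_nonneg.2 hxg) h1, sq_nonneg x]
  -- g - p k ≥ g - (x+g) k = E  with k = x + g - 2gx ≥ 0
  have h2 : 0 ≤ (x + g - p) * (x + g - 2 * g * x) := mul_nonneg (by linarith) hk
  nlinarith [mul_nonneg (sub_nonneg.2 hx1) h2, mul_nonneg (sub_nonneg.2 hx1) hE]

/-! ### The three shallow cells over an abstract vertical block -/

set_option maxHeartbeats 800000 in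
/-- **cell S-A** (shallow, row-0 pair light `T + ag − 2l < x(h−l)`): the rest `R` of the row-0 low goes into `h` at the light gate
`γ₀`, `t = t_max = γg/(1−g)`; hypothesis `hπ`: the point weight left at `h` is nonnegative, `R/((1−x)(p−w)) ≤ γ + R` in coordinates.
The vertical block `(R, λᵥ, π_a, γᵥ)` is abstract. [this work] -/
theorem windowPair_shallow_A (x g T γ R lamv πa γv : ℝ) (j' M l a h : ℕ) (hx0 : 0 < x) (hx1 : x < 1) (hxg : x ≤ g) (hg1 : g < 1)
    (ha : 1 ≤ a) (hlaj : l + a ≤ j') (hlow : 2 * (l : ℝ) < T) (hjha : j' + 1 ≤ h + a) (hhj : h ≤ j') (hhM : h ≤ M)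
    (hcomp : T < (l : ℝ) + h) (hlight : T - 2 * (l : ℝ) < x * ((h : ℝ) - l)) (hmid : T + (a : ℝ) * g ≤ 2 * (h : ℝ))
    (hγ : γ = x ^ 2 + (1 - x) * ((T - 2 * (l : ℝ)) / ((h : ℝ) - l)))
    (hR0 : 0 ≤ R) (hlamv : 0 ≤ lamv) (hπa : 0 ≤ πa) (hγv : 0 ≤ γv ∧ γv ≤ 1)
    (hbalv1 : lamv * (1 - γv) = (1 - γ) * (1 - g) - R) (hbalv2 : lamv * γv + πa = (1 - γ) * g)
    (hvalv : 0 < lamv → T + (a : ℝ) * g ≤ 2 * (l : ℝ) + (((l + a : ℕ) : ℝ) - (l : ℝ)) * (if x ≤ γv then γv else (γv - x ^ 2) / (1 - x)))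
    (hvala : 0 < πa → T + (a : ℝ) * g ≤ 2 * ((l + a : ℕ) : ℝ))
    (hlight0 : T + (a : ℝ) * g - 2 * (l : ℝ) < x * ((h : ℝ) - l))
    (hπ : R / ((1 - x) * (1 + x - (T + (a : ℝ) * g - 2 * (l : ℝ)) / ((h : ℝ) - l))) ≤ γ + R) :
    ∃ t : ℝ, 0 ≤ t ∧ t * (1 - g) ≤ γ * g ∧
      DECAtT x (T + (a : ℝ) * g) j' (M + a) (fun k => (1 - γ) * (1 - g) * (if k = l then (1 : ℝ) else 0)
        + (1 - γ) * g * (if k = l + a then (1 : ℝ) else 0) + (γ * (1 - g) + t * (1 - g)) * (if k = h then (1 : ℝ) else 0)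
        + (γ * g - t * (1 - g)) * (if k = h + a then (1 : ℝ) else 0)) := by
  have hg0 : 0 < g := lt_of_lt_of_le hx0 hxg
  obtain ⟨p, w, hp, hw, hp1, hpx, hw0, hD, hγp, hρ₀, hγpos⟩ := windowPair_coords x g T l a h hx1 hg0 ha hlow hcomp hlight
  rw [hγp] at hγ
  have hg1ne : (1 - g) ≠ 0 := ne_of_gt (by linarith)
  set ρ₀ : ℝ := (T + (a : ℝ) * g - 2 * (l : ℝ)) / ((h : ℝ) - l) with hρ₀d
  set γ₀ : ℝ := x ^ 2 + (1 - x) * ρ₀ with hγ₀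
  have hρ₀x : ρ₀ < x := by rw [hρ₀d, div_lt_iff₀ hD]; linarith
  have hag : (0 : ℝ) ≤ (a : ℝ) * g := by positivity
  have hρ₀0 : 0 < ρ₀ := by rw [hρ₀d]; exact div_pos (by linarith) hD
  have hγ₀x : γ₀ < x := by rw [hγ₀]; nlinarith [mul_lt_mul_of_pos_left hρ₀x (sub_pos.2 hx1)]
  have hγ₀0 : 0 ≤ γ₀ := by rw [hγ₀]; nlinarith [mul_nonneg (sub_nonneg.2 hx1.le) hρ₀0.le, sq_nonneg x]
  have h1γ₀ : 1 - γ₀ = (1 - x) * (1 + x - ρ₀) := by rw [hγ₀]; ring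
  have h1γ₀pos : 0 < 1 - γ₀ := by linarith
  set lam₀ : ℝ := R / (1 - γ₀) with hlam₀
  have hlam₀0 : 0 ≤ lam₀ := div_nonneg hR0 h1γ₀pos.le
  have hbal₀ : lam₀ * (1 - γ₀) = R := div_mul_cancel₀ _ h1γ₀pos.ne'
  have hlam₀le : lam₀ ≤ γ + R := by rw [hlam₀, h1γ₀]; exact hπ
  have hπ' : 0 ≤ γ * (1 - g) + γ * g - 0 * 0 - lam₀ * γ₀ := by nlinarith [hbal₀, hlam₀le]
  have ht : γ * g / (1 - g) * (1 - g) = γ * g := div_mul_cancel₀ _ hg1ne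
  refine ⟨γ * g / (1 - g), div_nonneg (mul_nonneg (by rw [hγ]; exact hγpos.le) hg0.le) (by linarith), by rw [ht], ?_⟩
  simp only [ht]
  refine windowPair_decAtT_of_weights x (T + (a : ℝ) * g) j' (M + a) l a h
    ((1 - γ) * (1 - g)) ((1 - γ) * g) (γ * (1 - g) + γ * g) (γ * g - γ * g)
    0 γv γ₀ 0 lamv lam₀ 0 πa (γ * (1 - g) + γ * g - 0 * 0 - lam₀ * γ₀) 0
    hx0.le hx1.le ha (by exact_mod_cast (show (l : ℝ) < h by linarith)) hlaj hhj hjha (by omega) hmid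
    ⟨le_rfl, zero_le_one⟩ hγv ⟨hγ₀0, by linarith⟩ le_rfl hlamv hlam₀0 le_rfl hπa hπ' le_rfl
    ?_ ?_ ?_ ?_ ?_ ?_ ?_ ?_ ?_
  · linear_combination hbalv1 + hbal₀
  · linear_combination hbalv2
  · ring
  · ring
  · ring
  · intro h0; exact absurd h0 (lt_irrefl 0)
  · exact hvalv
  · intro _
    rw [if_neg (not_le.2 hγ₀x)]
    have e : (γ₀ - x ^ 2) / (1 - x) = ρ₀ := by
      rw [hγ₀, add_sub_cancel_left, mul_div_cancel_left₀ _ (by linarith : (1 - x) ≠ 0)]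
    rw [e, hρ₀d, mul_div_cancel₀ _ hD.ne']
    linarith
  · exact hvala

set_option maxHeartbeats 800000 in
/-- **cell S-B** (shallow, row-0 pair not light, and the giant can take the rest of the row-0 low: `R·x ≤ γg(1−x)`): the rest `R`
goes into the giant at gate `x`, `t(1−g) = γg − Rx/(1−x)`; no further inequality. [this work] -/
theorem windowPair_shallow_B (x g T γ R lamv πa γv : ℝ) (j' M l a h : ℕ) (hx0 : 0 < x) (hx1 : x < 1) (hxg : x ≤ g) (hg1 : g < 1)
    (ha : 1 ≤ a) (hlaj : l + a ≤ j') (hlow : 2 * (l : ℝ) < T) (hjha : j' + 1 ≤ h + a) (hhj : h ≤ j') (hhM : h ≤ M)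
    (hcomp : T < (l : ℝ) + h) (hlight : T - 2 * (l : ℝ) < x * ((h : ℝ) - l)) (hmid : T + (a : ℝ) * g ≤ 2 * (h : ℝ))
    (hγ : γ = x ^ 2 + (1 - x) * ((T - 2 * (l : ℝ)) / ((h : ℝ) - l)))
    (hR0 : 0 ≤ R) (hlamv : 0 ≤ lamv) (hπa : 0 ≤ πa) (hγv : 0 ≤ γv ∧ γv ≤ 1)
    (hbalv1 : lamv * (1 - γv) = (1 - γ) * (1 - g) - R) (hbalv2 : lamv * γv + πa = (1 - γ) * g)
    (hvalv : 0 < lamv → T + (a : ℝ) * g ≤ 2 * (l : ℝ) + (((l + a : ℕ) : ℝ) - (l : ℝ)) * (if x ≤ γv then γv else (γv - x ^ 2) / (1 - x)))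
    (hvala : 0 < πa → T + (a : ℝ) * g ≤ 2 * ((l + a : ℕ) : ℝ))
    (hside : R * x ≤ γ * g * (1 - x)) :
    ∃ t : ℝ, 0 ≤ t ∧ t * (1 - g) ≤ γ * g ∧
      DECAtT x (T + (a : ℝ) * g) j' (M + a) (fun k => (1 - γ) * (1 - g) * (if k = l then (1 : ℝ) else 0)
        + (1 - γ) * g * (if k = l + a then (1 : ℝ) else 0) + (γ * (1 - g) + t * (1 - g)) * (if k = h then (1 : ℝ) else 0)
        + (γ * g - t * (1 - g)) * (if k = h + a then (1 : ℝ) else 0)) := by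
  have hg0 : 0 < g := lt_of_lt_of_le hx0 hxg
  obtain ⟨p, w, hp, hw, hp1, hpx, hw0, hD, hγp, hρ₀, hγpos⟩ := windowPair_coords x g T l a h hx1 hg0 ha hlow hcomp hlight
  rw [hγp] at hγ
  have hx1ne : (1 - x) ≠ 0 := ne_of_gt (by linarith)
  have hg1ne : (1 - g) ≠ 0 := ne_of_gt (by linarith)
  set s : ℝ := γ * g - R * x / (1 - x) with hs
  have hs0 : 0 ≤ s := by rw [hs, sub_nonneg, div_le_iff₀ (by linarith : (0:ℝ) < 1 - x)]; linarith
  have hsle : s ≤ γ * g := by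
    rw [hs, sub_le_self_iff]; exact div_nonneg (mul_nonneg hR0 hx0.le) (by linarith)
  have hγ0 : 0 ≤ γ := by rw [hγ]; exact hγpos.le
  have hπ' : 0 ≤ γ * (1 - g) + s - 0 * 0 - 0 * 0 := by nlinarith
  have ht : s / (1 - g) * (1 - g) = s := div_mul_cancel₀ _ hg1ne
  refine ⟨s / (1 - g), div_nonneg hs0 (by linarith), by rw [ht]; exact hsle, ?_⟩
  simp only [ht]
  refine windowPair_decAtT_of_weights x (T + (a : ℝ) * g) j' (M + a) l a h
    ((1 - γ) * (1 - g)) ((1 - γ) * g) (γ * (1 - g) + s) (γ * g - s)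
    0 γv 0 0 lamv 0 (R / (1 - x)) πa (γ * (1 - g) + s - 0 * 0 - 0 * 0) 0
    hx0.le hx1.le ha (by exact_mod_cast (show (l : ℝ) < h by linarith)) hlaj hhj hjha (by omega) hmid
    ⟨le_rfl, zero_le_one⟩ hγv ⟨le_rfl, zero_le_one⟩ le_rfl hlamv le_rfl (div_nonneg hR0 (by linarith)) hπa hπ' le_rfl
    ?_ ?_ ?_ ?_ ?_ ?_ ?_ ?_ ?_
  · rw [div_mul_cancel₀ _ hx1ne]; linear_combination hbalv1
  · linear_combination hbalv2
  · ring
  · rw [hs]; field_simp; ring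
  · ring
  · intro h0; exact absurd h0 (lt_irrefl 0)
  · exact hvalv
  · intro h0; exact absurd h0 (lt_irrefl 0)
  · exact hvala

set_option maxHeartbeats 800000 in
/-- **cell S-C** (shallow, row-0 pair HEAVY and compatible, `x(h−l) ≤ T + ag − 2l < h − l`, and `γg(1−x) < R·x`): `t = 0`, the giant is
filled by `γg(1−x)/x` of the row-0 low, the rest `R − γg(1−x)/x` goes into `h` through the heavy pair at gate `ρ₀`; hypothesis `hπ`:
`(R − γg(1−x)/x)·ρ₀/(1 − ρ₀) ≤ γ(1−g)`. [this work] -/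
theorem windowPair_shallow_C (x g T γ R lamv πa γv : ℝ) (j' M l a h : ℕ) (hx0 : 0 < x) (hx1 : x < 1) (hxg : x ≤ g)
    (ha : 1 ≤ a) (hlaj : l + a ≤ j') (hlow : 2 * (l : ℝ) < T) (hjha : j' + 1 ≤ h + a) (hhj : h ≤ j') (hhM : h ≤ M)
    (hcomp : T < (l : ℝ) + h) (hlight : T - 2 * (l : ℝ) < x * ((h : ℝ) - l)) (hmid : T + (a : ℝ) * g ≤ 2 * (h : ℝ))
    (hγ : γ = x ^ 2 + (1 - x) * ((T - 2 * (l : ℝ)) / ((h : ℝ) - l)))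
    (hlamv : 0 ≤ lamv) (hπa : 0 ≤ πa) (hγv : 0 ≤ γv ∧ γv ≤ 1)
    (hbalv1 : lamv * (1 - γv) = (1 - γ) * (1 - g) - R) (hbalv2 : lamv * γv + πa = (1 - γ) * g)
    (hvalv : 0 < lamv → T + (a : ℝ) * g ≤ 2 * (l : ℝ) + (((l + a : ℕ) : ℝ) - (l : ℝ)) * (if x ≤ γv then γv else (γv - x ^ 2) / (1 - x)))
    (hvala : 0 < πa → T + (a : ℝ) * g ≤ 2 * ((l + a : ℕ) : ℝ))
    (hheavy0 : x * ((h : ℝ) - l) ≤ T + (a : ℝ) * g - 2 * (l : ℝ)) (hcompat0 : T + (a : ℝ) * g < (l : ℝ) + h)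
    (hside : γ * g * (1 - x) < R * x)
    (hπ : (R - γ * g * (1 - x) / x) * ((T + (a : ℝ) * g - 2 * (l : ℝ)) / ((h : ℝ) - l))
      / (1 - (T + (a : ℝ) * g - 2 * (l : ℝ)) / ((h : ℝ) - l)) ≤ γ * (1 - g)) :
    ∃ t : ℝ, 0 ≤ t ∧ t * (1 - g) ≤ γ * g ∧
      DECAtT x (T + (a : ℝ) * g) j' (M + a) (fun k => (1 - γ) * (1 - g) * (if k = l then (1 : ℝ) else 0)
        + (1 - γ) * g * (if k = l + a then (1 : ℝ) else 0) + (γ * (1 - g) + t * (1 - g)) * (if k = h then (1 : ℝ) else 0)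
        + (γ * g - t * (1 - g)) * (if k = h + a then (1 : ℝ) else 0)) := by
  have hg0 : 0 < g := lt_of_lt_of_le hx0 hxg
  obtain ⟨p, w, hp, hw, hp1, hpx, hw0, hD, hγp, hρ₀, hγpos⟩ := windowPair_coords x g T l a h hx1 hg0 ha hlow hcomp hlight
  rw [hγp] at hγ
  have hxne : x ≠ 0 := ne_of_gt hx0
  set ρ₀ : ℝ := (T + (a : ℝ) * g - 2 * (l : ℝ)) / ((h : ℝ) - l) with hρ₀d
  have hρ₀x : x ≤ ρ₀ := by rw [hρ₀d, le_div_iff₀ hD]; linarith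
  have hρ₀1 : ρ₀ < 1 := by rw [hρ₀d, div_lt_one hD]; linarith
  have h1ρ₀ : 0 < 1 - ρ₀ := by linarith
  set q : ℝ := R - γ * g * (1 - x) / x with hq
  have hq0 : 0 ≤ q := by rw [hq, sub_nonneg, div_le_iff₀ hx0]; linarith
  set lam₀ : ℝ := q / (1 - ρ₀) with hlam₀
  have hlam₀0 : 0 ≤ lam₀ := div_nonneg hq0 h1ρ₀.le
  have hbal₀ : lam₀ * (1 - ρ₀) = q := div_mul_cancel₀ _ h1ρ₀.ne'
  have hπ' : 0 ≤ γ * (1 - g) + 0 * (1 - g) - 0 * 0 - lam₀ * ρ₀ := by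
    have : lam₀ * ρ₀ = q * ρ₀ / (1 - ρ₀) := by rw [hlam₀]; ring
    rw [this]; linarith [hπ]
  have hγ0 : 0 ≤ γ := by rw [hγ]; exact hγpos.le
  refine ⟨0, le_rfl, by nlinarith [mul_nonneg hγ0 hg0.le], ?_⟩
  refine windowPair_decAtT_of_weights x (T + (a : ℝ) * g) j' (M + a) l a h
    ((1 - γ) * (1 - g)) ((1 - γ) * g) (γ * (1 - g) + 0 * (1 - g)) (γ * g - 0 * (1 - g))
    0 γv ρ₀ 0 lamv lam₀ (γ * g / x) πa (γ * (1 - g) + 0 * (1 - g) - 0 * 0 - lam₀ * ρ₀) 0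
    hx0.le hx1.le ha (by exact_mod_cast (show (l : ℝ) < h by linarith)) hlaj hhj hjha (by omega) hmid
    ⟨le_rfl, zero_le_one⟩ hγv ⟨by linarith, hρ₀1.le⟩ le_rfl hlamv hlam₀0
    (div_nonneg (mul_nonneg hγ0 hg0.le) hx0.le) hπa hπ' le_rfl
    ?_ ?_ ?_ ?_ ?_ ?_ ?_ ?_ ?_
  · -- balance at l: vertical block + q into h + γg(1-x)/x into the giant
    have e : γ * g / x * (1 - x) = γ * g * (1 - x) / x := by ring
    rw [e]; linear_combination hbalv1 + hbal₀
  · linear_combination hbalv2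
  · ring
  · rw [div_mul_cancel₀ _ hxne]; ring
  · ring
  · intro h0; exact absurd h0 (lt_irrefl 0)
  · exact hvalv
  · -- validity of (l, h): heavy credit pair at gate ρ₀, credit exactly T'
    intro _
    rw [if_pos hρ₀x, hρ₀d, mul_div_cancel₀ _ hD.ne']
    linarith
  · exact hvala

end LawDec

end Quant

end Summit.CriticalPhenomena.PercolationContinuityZ3.Theorems
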